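import Literature.AnabelianGeometry.EtaleTheta.ThetaCohomologyAnchored
import HarnessLib

/-!
# [EtTh] §1, Prop. 1.4 (iii): an ANCHORED non-cuspidal point is determined by its decomposition group

Mochizuki, *The étale theta function …*, Publ. RIMS **45** (2009) [EtTh], §1, Prop. 1.4 (iii), PRIMS PDF
p. 22 [cite: MochizukiEtTh2009, Prop 1.4 (iii) p.22]: "if `L` is a finite extension of `K̈`, and
`y ∈ Ÿ(L)` is a non-cuspidal point, then the restricted classes `O^×_K̈ · η̈^Θ|_y ∈ H¹(G_L, Δ_Θ) ≅
H¹(G_L, Ẑ(1)) ≅ (L^×)^∧` … lie in `L^× ⊆ (L^×)^∧` and are equal to the values `O^×_K̈ · Θ̈(y)`".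

abc-iut cell, PROOF-ONLY companion (no definition, no named fact; seat abc-iut-w5-d115 gen 4, out of the
RQ7 kernel probe of p422290) of abc-iut-L2-t1's `ThetaCohomologyAnchored.lean` (`ThetaSetting.AnchoredPoint`,
`Prop14iiiValuesAnchored`). In print `y` is a POINT, and both "`H¹(G_L, Δ_Θ) ≅ (L^×)^∧`" and `Ü(y)` are
determined by `D_y`; the interface record `NonCuspidalPoint` carried them as independent data, whence the
vacuity of the struck F-0590 (`ThetaSetting.not_prop14iiiValues`, abc-iut-w5-d140 / abc-iut-L2-d1: the
re-coordinatised record `(D_y, q̈^{±1}·Ü(y), evalAt)`). L2-t1's repair added the two printed sentences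
`evalAt_injective`, `evalAt_logUdd` and proved `AnchoredPoint.coord_unique` (the coordinate is determined by
`(D_y, evalAt)`). THIS file closes the loop IN THE KERNEL:

* `AnchoredPoint.evalAt_bijective` — the evaluation `H¹(D_y, Δ_Θ) → (K̈^×)^∧` of an anchored point is a
  bijection (surjective by `evalAt_kum`, injective by the anchoring), and `AnchoredPoint.eq_res_kum_evalAt`:
  every class of `H¹(D_y, Δ_Θ)` IS the restricted Kummer class of the constant `ev_y(x)`;
* `AnchoredPoint.coord_eq_of_Dpt_eq`, `AnchoredPoint.evalAt_heq_of_Dpt_eq`, **`AnchoredPoint.ext_of_Dpt_eq`** —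
  two anchored points with the same decomposition group are EQUAL (evaluation map and coordinate included):
  the re-coordinatisation degree of freedom is gone entirely, not only for the coordinate; in particular the
  F-0590 witnesses are not anchored points (`AnchoredPoint.coord_eq_of_Dpt_eq` with `q̈·Ü(y) ≠ Ü(y)`), and a
  translated anchored point (abc-iut-L2-d1, `Sec1AnchoredTranslatePoints.lean`) is UNIQUE given its
  decomposition group `σ^{−a}·D_y·σ^{a}`.
Pure consequences of the fields of `NonCuspidalPoint` / `AnchoredPoint`; nothing of [EtTh] is asserted; no side
is taken on [IUTchIII] Cor. 3.12.
-/

namespace Literature.AnabelianGeometry.EtaleTheta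

namespace ThetaSetting

namespace AnchoredPoint

variable {p : ℕ} [Fact p.Prime] {D : ThetaSetting p} {E : D.KummerData}

/-- **Every class of `H¹(D_y, Δ_Θ)` at an anchored point is the restricted Kummer class of a constant**,
namely of its value `ev_y(x) ∈ (K̈^×)^∧` ("`H¹(G_L, Δ_Θ) ≅ H¹(G_L, Ẑ(1)) ≅ (L^×)^∧`", p. 22): `evalAt_kum`
and injectivity of `evalAt`. [cite: MochizukiEtTh2009, Prop 1.4 (iii) p.22] -/
theorem eq_res_kum_evalAt (y : AnchoredPoint E) (x : D.H1 y.Dpt) :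
    x = ContH1.res D.toTheta D.DeltaTheta y.Dpt_le (D.inflTheta D.GtpYdd (E.kumYdd (y.evalAt x))) :=
  y.evalAt_injective (by rw [y.evalAt_kum])

/-- The evaluation map of an anchored point is **surjective** (already for `NonCuspidalPoint`: constants
evaluate to themselves, `evalAt_kum`). [cite: MochizukiEtTh2009, Prop 1.4 (iii) p.22] -/
theorem evalAt_surjective (y : AnchoredPoint E) : Function.Surjective y.evalAt :=
  fun c => ⟨_, y.evalAt_kum c⟩

/-- **The evaluation map `H¹(D_y, Δ_Θ) → (K̈^×)^∧` of an anchored point is a bijection** — the printed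
"`≅`" of Prop. 1.4 (iii), p. 22, with `L = K̈`. [cite: MochizukiEtTh2009, Prop 1.4 (iii) p.22] -/
theorem evalAt_bijective (y : AnchoredPoint E) : Function.Bijective y.evalAt :=
  ⟨y.evalAt_injective, y.evalAt_surjective⟩

/-- **Two anchored points with the same decomposition group have the same evaluation map** (as `HEq`,
the domains `H¹(D_y, Δ_Θ)` being indexed by the group): both are inverse to `c ↦ κ(c)|_{D_y}`.
[cite: MochizukiEtTh2009, Prop 1.4 (iii) p.22] -/
theorem evalAt_heq_of_Dpt_eq (y y' : AnchoredPoint E) (h : y.Dpt = y'.Dpt) : HEq y.evalAt y'.evalAt := by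
  obtain ⟨⟨Dpt, Dpt_le, hinj, hmap, coord, hne, ev, hev⟩, hinj1, hlog1⟩ := y
  obtain ⟨⟨Dpt', Dpt_le', hinj', hmap', coord', hne', ev', hev'⟩, hinj2, hlog2⟩ := y'
  dsimp only at h
  subst h
  refine heq_of_eq (MonoidHom.ext fun x => ?_)
  dsimp only at hinj1 hev hev' ⊢
  have hx : x = ContH1.res D.toTheta D.DeltaTheta Dpt_le (D.inflTheta D.GtpYdd (E.kumYdd (ev x))) :=
    hinj1 (by rw [hev])
  conv_rhs => rw [hx, hev']

/-- **Two anchored points with the same decomposition group have the same coordinate `Ü(y)`**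
(`evalAt_logUdd` at both, the evaluation maps being equal, and `K̈^× ↪ (K̈^×)^∧`). In particular the
re-coordinatised records `(D_y, q̈^{±1}·Ü(y), evalAt)` behind the vacuity of F-0590 are not anchored points.
[cite: MochizukiEtTh2009, Prop 1.4 (iii) p.22] -/
theorem coord_eq_of_Dpt_eq (y y' : AnchoredPoint E) (h : y.Dpt = y'.Dpt) : y.coord = y'.coord := by
  obtain ⟨⟨Dpt, Dpt_le, hinj, hmap, coord, hne, ev, hev⟩, hinj1, hlog1⟩ := y
  obtain ⟨⟨Dpt', Dpt_le', hinj', hmap', coord', hne', ev', hev'⟩, hinj2, hlog2⟩ := y'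
  dsimp only at h
  subst h
  dsimp only at hinj1 hev hev' hlog1 hlog2 ⊢
  have hev_eq : ev = ev' := by
    refine MonoidHom.ext fun x => ?_
    have hx : x = ContH1.res D.toTheta D.DeltaTheta Dpt_le (D.inflTheta D.GtpYdd (E.kumYdd (ev x))) :=
      hinj1 (by rw [hev])
    conv_rhs => rw [hx, hev']
  subst hev_eq
  exact E.toKddHat_injective (hlog1.symm.trans hlog2)

/-- **An anchored non-cuspidal point is determined by its decomposition group**: `y.Dpt = y'.Dpt → y = y'`
— as in print, where `Ü(y)` and the evaluation isomorphism are read off `D_y`. Hence an anchored point over a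
prescribed decomposition group (e.g. a translate `σ^{−a}·D_y·σ^{a}`) is unique when it exists.
[cite: MochizukiEtTh2009, Prop 1.4 (iii) p.22] -/
theorem ext_of_Dpt_eq (y y' : AnchoredPoint E) (h : y.Dpt = y'.Dpt) : y = y' := by
  have hc := coord_eq_of_Dpt_eq y y' h
  have hev := evalAt_heq_of_Dpt_eq y y' h
  obtain ⟨⟨Dpt, Dpt_le, hinj, hmap, coord, hne, ev, hev0⟩, hinj1, hlog1⟩ := y
  obtain ⟨⟨Dpt', Dpt_le', hinj', hmap', coord', hne', ev', hev0'⟩, hinj2, hlog2⟩ := y'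
  dsimp only at h hc hev
  subst h
  subst hc
  have hev' : ev = ev' := eq_of_heq hev
  subst hev'
  rfl

/-- `y = y' ↔ D_y = D_{y'}` for anchored points. [cite: MochizukiEtTh2009, Prop 1.4 (iii) p.22] -/
theorem ext_iff_Dpt_eq (y y' : AnchoredPoint E) : y = y' ↔ y.Dpt = y'.Dpt :=
  ⟨fun h => h ▸ rfl, ext_of_Dpt_eq y y'⟩

end AnchoredPoint

end ThetaSetting

end Literature.AnabelianGeometry.EtaleTheta
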